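import Mathlib.LinearAlgebra.Span.Basic
import Mathlib.Algebra.Module.Submodule.Map
import Mathlib.Algebra.Module.Submodule.Range
import Mathlib.LinearAlgebra.Prod
import Mathlib.Tactic.Module
import Summits.BirchSwinnertonDyer.Rank1Residual.X4.SaturationByDegeneracyTrace
import HarnessLib

/-!
# The `U_p`-nilpotent part at the semistable level: the lattice clause, the transpose convention and case (B1) — companion to `UpNilpotentPartOfSemistableLevel` (cell `b2b-bsdres`, seat additive-p4 gen 38, line V64/V66; REFEREE 2 R2-155.3 (ii)/(iii))

HONEST FRAMING (verbatim, cell `b2b-bsdres`): the goal of the cell is to DELETE the COMBINATION-SHAPED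
residual classes for ALL analytic-rank `≤ 1` curves over `ℚ` — "full BSD formula for every rank `≤ 1`
curve in class `C`" assembled STRICTLY from published theorems — so that the rank-`≤ 1` remainder
becomes exactly the CONSTRUCTION-SHAPED classes, which are TYPED (missing-input Props), NOT attempted;
this is not "finishing BSD". This file: TOOL theorems (pure module algebra; 0 defs, 0 facts, nothing
booked; X4 stays CONSTRUCTION-SHAPED; no mark moves).

## What is proved (memo V64 §3, Proposition V64-B; REFEREE 2's bounded consult R2-155.3)

* (ii) CONVENTION-ROBUSTNESS. `U_intertwiner_transpose_apply`: under the TRANSPOSE convention for `U_p`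
  on the `p`-old pair — `U (d₁ x) = d₁ (t•x) + dₚ x`, `U (dₚ x) = −(p • d₁ x)` (matrix `[[t, −p],[1, 0]]`,
  homology rather than q-expansions) — the intertwiner is `u₀ • d₁ + dₚ`; with convention (A) of the
  main file it is `d₁ + (u₀ − t) • dₚ`. Either way the `u₀`-eigenlattice of the old part is the graph
  of a scalar over one of the two coordinates, so the structural conclusion of Prop. V64-B does not
  depend on the convention (the referee's checkpoint (ii)).
* (iii) THE LATTICE CLAUSE `O_{ℓ_i}(Y) ∩ Y^{nil} = φ₀(O_{ℓ_i}(K))`. `fixed_inf_range_eq_map_fixed`: for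
  an endomorphism `e` of `Y`, an idempotent `e₁` of `Y₁` and `i′ : Y₁ → Y` with `i′ ∘ e₁ = e ∘ i′`,
  `Fix(e) ⊓ range i′ = i′(Fix e₁)`; `inf_range_eq_map_range_of_comm`: plus `Fix(e₁) = range φ₁` and a
  commuting square `i′ ∘ φ₁ = φ₀ ∘ i″` gives `Fix(e) ⊓ range i′ = φ₀(range i″)`;
  `oldLattice_inf_nilpotentPart_eq` assembles the two. In the application `e`, `e₁` are Hensel's
  idempotents of the `U_p`-nilpotent parts at levels `pM` and `pM/ℓ_i` (squared), `i′`, `i″` the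
  `ℓ_i`-degeneracy pair maps (`U_p`-equivariant, hence `e`-equivariant: `e` is a limit of polynomials
  in `U_p`), `φ₀`, `φ₁` the intertwiners (degeneracies at `ℓ_i ≠ p` commute with those at `p` and with
  `u₀ − T_p`). With `e ∈ End(Y)` an honest endomorphism NO saturation input enters this clause — the
  referee's caveat ("saturation is load-bearing") applies to the variant defining the nilpotent part
  through `Y ⊗ ℚ`; in the main file saturation (Ihara) is used exactly once, as injectivity of `j′`.
* Case (B1) (`a_p(ρ̄) ∈ 𝔪`: `Y = j′(K × K)`, `O(Y) = j′(O(K) × O(K))`): `smul_mem_imp_iff_prod` — `S`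
  is `r`-saturated in `K` iff `S × S` is in `K × K` (one direction is K110's `prod_smul_mem_imp`).

## References (context only; the proofs are elementary)

* A. Wiles, Ann. of Math. 141 (1995), §2. [cite: Wiles1995, §2]
* K. Ribet, Proc. ICM 1983 (1984), Thm. 4.1. [cite: Ribet1984ICM, Thm. 4.1]
-/

namespace Summit.BirchSwinnertonDyer.Rank1Residual.LevelLowering

section Transpose

variable {R K Y : Type*} [CommRing R] [AddCommGroup K] [Module R K] [AddCommGroup Y] [Module R Y]

/-- **Convention-robustness** (R2-155.3 (ii)): under the TRANSPOSE convention
`U (d₁ x) = d₁ (t•x) + dₚ x`, `U (dₚ x) = −(p • d₁ x)` (matrix `[[t, −p],[1, 0]]`, homology rather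
than forms) the intertwiner is `u₀ • d₁ + dₚ`: `U ((u₀ • d₁ + dₚ) x) = u₀ • (u₀ • d₁ + dₚ) x`. So the
`u₀`-eigenlattice of the old part is again the graph of a scalar (in the other coordinate) and the
results of the main file hold verbatim with `Prod.swap`ped coordinates. [cite: Wiles1995, §2] -/
theorem U_intertwiner_transpose_apply (t p u₀ : R) (hu : u₀ * u₀ = t * u₀ - p)
    (d₁ dₚ : K →ₗ[R] Y) (U : Y →ₗ[R] Y)
    (hU₁ : ∀ x, U (d₁ x) = d₁ (t • x) + dₚ x) (hUₚ : ∀ x, U (dₚ x) = -(p • d₁ x)) (x : K) :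
    U ((u₀ • d₁ + dₚ) x) = u₀ • (u₀ • d₁ + dₚ) x := by
  have hp : p = t * u₀ - u₀ * u₀ := by rw [hu]; ring
  subst hp
  simp only [LinearMap.add_apply, LinearMap.smul_apply, map_add, map_smul, hU₁, hUₚ]
  module

end Transpose

section LatticeClause

variable {R K K₁ Y Y₁ : Type*} [CommRing R] [AddCommGroup K] [Module R K] [AddCommGroup K₁]
  [Module R K₁] [AddCommGroup Y] [Module R Y] [AddCommGroup Y₁] [Module R Y₁]

/-- Fixed points of compatible idempotents: if `i′ ∘ e₁ = e ∘ i′` with `e₁` idempotent, then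
`Fix(e) ⊓ range i′ = i′(Fix e₁)` — no saturation needed (R2-155.3 (iii)). -/
theorem fixed_inf_range_eq_map_fixed (e : Y →ₗ[R] Y) (e₁ : Y₁ →ₗ[R] Y₁) (he₁ : ∀ z, e₁ (e₁ z) = e₁ z)
    (i' : Y₁ →ₗ[R] Y) (hcomm : ∀ z, i' (e₁ z) = e (i' z))
    (N : Submodule R Y) (hN : ∀ y, y ∈ N ↔ e y = y)
    (N₁ : Submodule R Y₁) (hN₁ : ∀ z, z ∈ N₁ ↔ e₁ z = z) :
    N ⊓ LinearMap.range i' = N₁.map i' := by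
  ext w
  constructor
  · rintro ⟨hw, ⟨z, rfl⟩⟩
    have hfix : e (i' z) = i' z := (hN _).mp hw
    refine ⟨e₁ z, (hN₁ _).mpr (he₁ z), ?_⟩
    rw [hcomm, hfix]
  · rintro ⟨z, hz, rfl⟩
    refine ⟨(hN _).mpr ?_, LinearMap.mem_range_self _ _⟩
    rw [← hcomm, (hN₁ _).mp hz]

/-- Diagram chase: if `Fix(e) ⊓ range i′ = i′(N₁)`, `N₁ = range φ₁` (the statement one level down) and
the square `i′ ∘ φ₁ = φ ∘ i″` commutes, then `Fix(e) ⊓ range i′ = φ(range i″)`. -/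
theorem inf_range_eq_map_range_of_comm (i' : Y₁ →ₗ[R] Y) (i'' : K₁ →ₗ[R] K) (φ : K →ₗ[R] Y)
    (φ₁ : K₁ →ₗ[R] Y₁) (hsq : i' ∘ₗ φ₁ = φ ∘ₗ i'')
    (N : Submodule R Y) (N₁ : Submodule R Y₁) (hN₁ : N₁ = LinearMap.range φ₁)
    (hNi : N ⊓ LinearMap.range i' = N₁.map i') :
    N ⊓ LinearMap.range i' = (LinearMap.range i'').map φ := by
  rw [hNi, hN₁, ← LinearMap.range_comp, hsq, LinearMap.range_comp]

/-- **The lattice clause (R2-155.3 (iii)): `O_{ℓ_i}(Y) ∩ N = φ₀(O_{ℓ_i}(K))`.** One level down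
(`K₁ = H_{M/ℓ_i,𝔪}² `, `Y₁ = H_{pM/ℓ_i,𝔪}²`, its idempotent `e₁` and intertwiner `φ₀⁽¹⁾` with
`Fix(e₁) = range φ₀⁽¹⁾` — the headline one level down) and the `ℓ_i`-degeneracy pair maps
`i′ : Y₁ → Y`, `i″ : K₁ → K` (`O_{ℓ_i}(Y) = range i′`, `O_{ℓ_i}(K) = range i″`) with `i′ ∘ e₁ = e ∘ i′`
(`e` is a limit of polynomials in `U_p`; `ℓ_i`-degeneracies are `U_p`-equivariant) and the commuting
square `i′ ∘ φ₀⁽¹⁾ = φ₀ ∘ i″` (degeneracies at `ℓ_i ≠ p` commute with those at `p` and with `u₀ − t`):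
then `Fix(e) ⊓ range i′ = φ₀(range i″)`. No saturation input. [cite: Ribet1984ICM, Thm. 4.1] -/
theorem oldLattice_inf_nilpotentPart_eq (e : Y →ₗ[R] Y) (e₁ : Y₁ →ₗ[R] Y₁)
    (he₁ : ∀ z, e₁ (e₁ z) = e₁ z) (i' : Y₁ →ₗ[R] Y) (i'' : K₁ →ₗ[R] K)
    (hcomm : ∀ z, i' (e₁ z) = e (i' z))
    (φ₀ : K →ₗ[R] Y) (φ₁ : K₁ →ₗ[R] Y₁) (hsq : i' ∘ₗ φ₁ = φ₀ ∘ₗ i'')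
    (N : Submodule R Y) (hN : ∀ y, y ∈ N ↔ e y = y)
    (N₁ : Submodule R Y₁) (hN₁ : ∀ z, z ∈ N₁ ↔ e₁ z = z) (hN₁eq : N₁ = LinearMap.range φ₁) :
    N ⊓ LinearMap.range i' = (LinearMap.range i'').map φ₀ :=
  inf_range_eq_map_range_of_comm i' i'' φ₀ φ₁ hsq N N₁ hN₁eq
    (fixed_inf_range_eq_map_fixed e e₁ he₁ i' hcomm N hN N₁ hN₁)

/-- Case (B1) of Prop. V64-B (`a_p(ρ̄) ∈ 𝔪`: `Y = j′(K × K)`, `O(Y) = j′(O(K) × O(K))`): `S` is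
`r`-saturated in `K` iff `S × S` is `r`-saturated in `K × K` (with K110's `prod_smul_mem_imp`). -/
theorem smul_mem_imp_iff_prod (r : R) (S : Submodule R K) :
    (∀ x : K, r • x ∈ S → x ∈ S) ↔ (∀ w : K × K, r • w ∈ S.prod S → w ∈ S.prod S) := by
  constructor
  · exact prod_smul_mem_imp r S
  · intro h x hx
    have := h (x, 0) (by
      rw [Submodule.mem_prod]; exact ⟨by simpa using hx, by simp⟩)
    exact (Submodule.mem_prod.mp this).1

end LatticeClause

end Summit.BirchSwinnertonDyer.Rank1Residual.LevelLowering
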